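import Literature.Geometry.Riemannian.ThreeShrinkerRicciLowerBound
import Literature.Geometry.Riemannian.ThreeShrinkerScalarCurvatureLog
import Literature.Geometry.Riemannian.ThreeShrinkerVolumeBound
import Literature.Geometry.Riemannian.ThreeShrinkerClassificationOfF2
import Literature.Geometry.Riemannian.RicciNonnegInfiniteVolume
import HarnessLib

/-!
# Noncompact three-dimensional shrinkers with `R > 0` have a null Ricci direction (Munteanu–Wang 2017, Thm. 2), modulo Calabi–Yau

The input **(F2)** of the classification of three-dimensional gradient shrinkers
(`ThreeShrinkerClassificationAssembly.lean`, `ThreeShrinkerClassificationOfF2.lean`): a complete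
connected normalised NONCOMPACT three-dimensional gradient shrinker with `R > 0` has a null vector
of `Ric` somewhere — the contrapositive, for `n = 3`, of O. Munteanu, J. Wang, *Positively curved
shrinking Ricci solitons are compact*, J. Differential Geom. 106 (2017), Thm. 2 ("a gradient
shrinking Ricci soliton with nonnegative sectional curvature and positive Ricci curvature must be
compact"; B. Chow, *Ricci solitons in low dimensions* (2023), Thm. 4.47), `sect ≥ 0` and
`Ric ≥ 0` being theorems of the tree (`ThreeShrinkerSectionalNonneg.lean`).

* **`ThreeShrinker.exists_ricci_null_of_infiniteVolume`** — (F2), CONDITIONAL on the named fact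
  `ricciNonneg_infiniteVolume` (Calabi–Yau 1976: complete noncompact `Ric ≥ 0` ⇒ infinite volume;
  volume comparison is not in the tree);
* **`threeShrinkerClassification_modelData_of_infiniteVolume`** — hence the classification fact
  `threeShrinkerClassification_modelData` from `ricciNonneg_infiniteVolume` alone.

PROOF of (F2) as printed (Munteanu–Wang; Chow, Thm. 4.47), all three steps theorems of the tree:
if `Ric > 0` everywhere then (1) `Ric ≥ (c/φ) h` on `{φ ≥ ρ}` (`ricci_ge_div_potential`, elliptic
minimum principle), (2) `R ≥ c log(φ/ρ)` there (`scalarCurvature_ge_log`, first-order minimum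
principle replacing the flow lines of `∇φ`), so `R ≥ 5/2` on `{φ ≥ ρ e^{3/c}}`, (3) hence the total
volume is finite (`riemVolume_univ_lt_top_of_scalarCurvature_ge`, cut-off integration of
`R + Δφ = 3/2`) — contradicting the infinite volume of complete noncompact manifolds with `Ric ≥ 0`.

## References

* O. Munteanu, J. Wang, J. Differential Geom. 106 (2017) = arXiv:1504.07898, Thm. 2. [MunteanuWang2017]
* O. Munteanu, J. Wang, arXiv:1606.01861, Thm. 1.2 (p. 3). [MunteanuWang2016]
* S.-T. Yau, Indiana Univ. Math. J. 25 (1976) 659–670. [Yau1976]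
-/

noncomputable section

set_option maxSynthPendingDepth 3

open Set Filter Module Metric MeasureTheory
open scoped Manifold ContDiff Topology NNReal ENNReal

namespace Literature.Geometry.Riemannian

open Lorentzian Lorentzian.PseudoRiemannianMetric

namespace ThreeShrinker

/-- **(F2) Munteanu–Wang 2017, Thm. 2, contrapositive, `n = 3`, modulo Calabi–Yau**: on a
complete connected normalised noncompact three-dimensional gradient shrinker with `R > 0` the
Ricci form has a null vector somewhere — conditional on `ricciNonneg_infiniteVolume`. See the
module docstring. [cite: MunteanuWang2017, Thm. 2] -/
theorem exists_ricci_null_of_infiniteVolume (hY : ricciNonneg_infiniteVolume)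
    (N : Type) [TopologicalSpace N] [T2Space N] [SecondCountableTopology N]
    [ChartedSpace (EuclideanSpace ℝ (Fin 3)) N] [IsManifold (𝓡 3) ∞ N] [ConnectedSpace N]
    [T3Space N] [MeasurableSpace N] [BorelSpace N]
    (h : PseudoRiemannianMetric (𝓡 3) ∞ (EuclideanSpace ℝ (Fin 3))
      (TangentSpace (𝓡 3) : N → Type _)) [h.HasLeviCivita] (φ : N → ℝ) (hh : h.IsRiemannian)
    (hcpl : ∀ (x : N) (r : ℝ≥0), IsCompact {y : N | h.edist hh x y ≤ r})
    (hφ : ContMDiff (𝓡 3) 𝓘(ℝ, ℝ) ∞ φ)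
    (hsol : ∀ (x : N) (X Y : TangentSpace (𝓡 3) x),
      h.ricci x X Y + h.hessian φ x X Y = (1 / 2 : ℝ) * h.val x X Y)
    (hnorm : ∀ x : N, h.scalarCurvature x + h.gradSq φ x = φ x)
    (hnc : NoncompactSpace N) (_hR : ∀ x : N, 0 < h.scalarCurvature x) :
    ∃ (p : N) (w : TangentSpace (𝓡 3) p), w ≠ 0 ∧ h.ricci p w w = 0 := by
  haveI := hnc
  by_contra hneg
  push Not at hneg
  have hRic0 := ricci_nonneg h φ hh hcpl hφ hsol hnorm
  have hpos : ∀ (x : N) (w : TangentSpace (𝓡 3) x), w ≠ 0 → 0 < h.ricci x w w :=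
    fun x w hw ↦ lt_of_le_of_ne (hRic0 x w) (Ne.symm (hneg x w hw))
  -- step 1: `Ric ≥ c/φ`
  obtain ⟨c, ρ, hc, hcρ, h1ρ, hRic⟩ := ricci_ge_div_potential h φ hh hcpl hφ hsol hnorm hpos
  -- step 2: `R ≥ c log(φ/ρ)`, hence `R ≥ 5/2` far out
  have hlog := scalarCurvature_ge_log h φ hh hcpl hφ hsol hnorm hc hcρ h1ρ hRic
  have hρpos : 0 < ρ := by linarith
  set ρ₂ : ℝ := ρ * Real.exp (3 / c) with hρ₂
  have hfar : ∀ x : N, ρ₂ ≤ φ x → 3 / 2 + 1 ≤ h.scalarCurvature x := by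
    intro x hx
    have hexp : 1 ≤ Real.exp (3 / c) := Real.one_le_exp (div_pos (by norm_num) hc).le
    have hρx : ρ ≤ φ x := le_trans (by nlinarith) hx
    have hφpos : 0 < φ x := hρpos.trans_le hρx
    have h1 := hlog x hρx
    have h2 : 3 / c ≤ Real.log (φ x / ρ) := by
      rw [Real.le_log_iff_exp_le (div_pos hφpos hρpos), le_div_iff₀ hρpos]
      linarith
    have h3 : 3 ≤ c * Real.log (φ x / ρ) := by
      have := mul_le_mul_of_nonneg_left h2 hc.le
      rwa [mul_div_cancel₀ _ hc.ne'] at this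
    linarith
  -- step 3: finite volume, contradicting Calabi–Yau
  have hfin := riemVolume_univ_lt_top_of_scalarCurvature_ge h φ hh hcpl hφ hsol hnorm one_pos hfar
  have hinf := hY 3 N h hh hcpl hRic0
  exact absurd hinf hfin.ne

end ThreeShrinker

/-- **The classification of three-dimensional shrinkers from Calabi–Yau's infinite-volume theorem
alone**: `threeShrinkerClassification_modelData` (Munteanu–Wang 2016, Thm. 1.2) follows from the
named fact `ricciNonneg_infiniteVolume`, (F1) and the three steps of (F2) being theorems.
[cite: MunteanuWang2016, Thm. 1.2 (p. 3)] [cite: MunteanuWang2017, Thm. 2] -/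
theorem threeShrinkerClassification_modelData_of_infiniteVolume (hY : ricciNonneg_infiniteVolume) :
    threeShrinkerClassification_modelData :=
  threeShrinkerClassification_modelData_of_F2 fun N _ _ _ _ _ _ _ _ _ h _ φ hh hcpl hφ hsol hnorm ↦
    ThreeShrinker.exists_ricci_null_of_infiniteVolume hY N h φ hh hcpl hφ hsol hnorm

end Literature.Geometry.Riemannian

end
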